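import Summits.NavierStokesRegularity.FunctionalMining.NoGo.TopBotEigSplitSharpFourMain
import Mathlib.Analysis.MeanInequalitiesPow
import HarnessLib

/-!
# K18 — the WALL CRITERION: general-`q` attainment of a share `c` reduced to typed one- and two-dimensional wall hypotheses

search for candidate a priori estimates; no regularity claim.

No-go branch (door D-K6 (c), the share window of the symmetrised top–bottom density), kernel side,
every real `q ≥ 1`. K16 (staged) proved the NECESSITY `TopBotEigSplitting q c → c ≤ c_axi(q)`
(`cAxi q`); K17 proved ATTAINMENT at `q = 4`, `c = 2/9 = c_axi(4)` by a Lewis-free composition route.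
This file abstracts K17's route into a CRITERION valid for every real `q ≥ 1` and every `c ≥ 0`:
with the wall defect

  `F_{q,c}(a, b) = a^q + b^q − c·(2(a² − ab + b²))^{q/2}`   (`wallF q c a b`, real powers)

(`= λ(A)^q + λ(−A)^q − c‖A‖^q` at `(a, b) = (λ(A), λ(−A))` on symmetric trace-free `A`), the three
hypotheses
* (N) `F_{q,c}(u, 1 − u) ≥ 0` for `u ∈ [1/3, 2/3]` (ONE-dimensional);
* (M) `F_{q,c}` is non-decreasing on the eigen-sector `{b ≤ 2a, a ≤ 2b}` (two-point form, TWO-dimensional;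
  pen: both partial derivatives `≥ 0` on the sector);
* (C) `u ↦ F_{q,c}(u, 1 − u)^{1/q}` is convex on `[1/3, 2/3]` (ONE-dimensional)
imply `TopBotEigSplitting q c` with the witness `M = 2^q`, `h(A) = F_{q,c}(λ(πA), λ(−πA))^{1/q}/2`
(`wallGauge q c`). So, together with K16, for every real `q > 1`:

  `c*(q) = c_axi(q)`  ⟸  (N) ∧ (M) ∧ (C) at `c = c_axi(q)`,

i.e. the remaining PEN part of the dictionary's "c_axi(q) is attained" (three hands) is EXACTLY the
sign of two explicit one-variable functions on `[1/3, 2/3]` and of a gradient on the sector — typed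
here as hypotheses, to be discharged per `q` (K17 discharged them at `q = 4`; §4 below re-derives
`TopBotEigSplitting 4 (2/9)` from the criterion as a consistency check).

## Main statements (namespace `Summit.NavierStokesRegularity.FunctionalMining.TopEig`)

* `topBotEigSplitting_of_wall (hq : 1 ≤ q) (hc : 0 ≤ c) (hN) (hM) (hC) : TopBotEigSplitting q c`;
* `wall_splitting_identity`: `λ(A)^q + λ(−A)^q = 2^q·h(A)^q + c‖A‖^q` on symmetric trace-free `A`
  (needs only (N));
* `convexOn_wallGauge`, `lipschitzWith_wallGauge` (need (N), (M), (C));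
* `wallF_four : wallF 4 (2/9) = quartF`, `wallPsi_four`, and K17's `topBotEigSplitting_four_sharp` re-derived through the criterion
  as a kernel-checked `example` (not a declaration: the statement `TopBotEigSplitting 4 (2/9)` is K17's by name).

NOT claimed: (N), (M), (C) for any `q ≠ 4` (pen statements of the dictionary / census hands at
`c = c_axi(q)`; their kernel discharge for general real `q` involves transcendental one-variable
inequalities and is not attempted); nothing on `heatDissipation`; no regularity claim.

Tree / staged results used, by name: K17 = `NoGo/TopBotEigSplitSharpFourScalar` + `NoGo/TopBotEigSplitSharpFourMain`
(`quartF`, `quartF_nonneg`, `quartF_mono`, `segPsi`, `convexOn_segPsi`; `IsSymTF.lam_sector`, `IsSymTF.norm_sq_eq_lam`), K10a/K10c bookkeeping (`Tens3`,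
`IsSymTF`, `tfProj`, `lam_smul`, `norm_tfProj_le`, `tfProj_of_isSymTF`, `sq_rpow_half`), `TopEigRayleigh` (`lam_add_le`,
`lam_le_norm`), K9 (`TopBotEigSplitting`); Mathlib `Real.add_rpow_le_rpow_add`, `Real.mul_rpow`,
`Real.rpow_mul`, `Real.rpow_rpow_inv`, `Real.rpow_inv_rpow`, `Real.div_rpow`, `LipschitzWith.of_le_add`.
[ours] = this programme's own elementary work.
v2 = v1 ead9b6610ec40e6b with the re-derivation `topBotEigSplitting_four_sharp'` DEMOTED to an `example` (its type
`TopBotEigSplitting 4 (2/9)` is verbatim K17's `topBotEigSplitting_four_sharp`, which lands first — census-1 (cc.265) T3a);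
every other byte of the Lean text is unchanged.
FILING (prove seat g28, REQUEST #33): declarations byte-identical to the no-go seat's staged `TopBotEigSplitWallCriterion.STAGING.lean` 6e06bc3ed108ffa8; additions: this line and 3 one-line `[bookkeeping]` docstrings on undocumented declarations (gate lint.docstring; RULING (ω)).
-/

noncomputable section

open Set Real

namespace Summit.NavierStokesRegularity.FunctionalMining

namespace TopEig

/-! ## 1. The wall defect `F_{q,c}` and its homogeneity -/

/-- **The wall defect** `F_{q,c}(a, b) = a^q + b^q − c·(2(a² − ab + b²))^{q/2}` (real powers). [ours] -/
def wallF (q c a b : ℝ) : ℝ := a ^ q + b ^ q - c * (2 * (a ^ 2 - a * b + b ^ 2)) ^ (q / 2)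

/-- `2(a² − ab + b²) = (a − b)² + a² + b² ≥ 0`. -/
theorem two_mul_quad_nonneg (a b : ℝ) : 0 ≤ 2 * (a ^ 2 - a * b + b ^ 2) := by
  nlinarith [sq_nonneg (a - b), sq_nonneg a, sq_nonneg b]

/-- `F_{q,c}` is `q`-homogeneous on the quadrant. [ours] -/
theorem wallF_smul (q c : ℝ) {t a b : ℝ} (ht : 0 ≤ t) (ha : 0 ≤ a) (hb : 0 ≤ b) :
    wallF q c (t * a) (t * b) = t ^ q * wallF q c a b := by
  unfold wallF
  have e1 : 2 * ((t * a) ^ 2 - t * a * (t * b) + (t * b) ^ 2) =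
      t ^ 2 * (2 * (a ^ 2 - a * b + b ^ 2)) := by ring
  rw [mul_rpow ht ha, mul_rpow ht hb, e1, mul_rpow (pow_nonneg ht 2) (two_mul_quad_nonneg a b),
    sq_rpow_half (q := q) ht]
  ring

/-- `F_{q,c}(0, 0) = 0` (`q ≠ 0`). -/
theorem wallF_zero {q : ℝ} (hq : q ≠ 0) (c : ℝ) : wallF q c 0 0 = 0 := by
  have hq2 : q / 2 ≠ 0 := div_ne_zero hq two_ne_zero
  simp [wallF, zero_rpow hq, zero_rpow hq2]

/-- Homogeneity to the segment `a + b = 1`: `F(a, b) = (a + b)^q·F(u, 1 − u)`, `u = a/(a + b)`. -/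
theorem wallF_eq_homog (q c : ℝ) {a b : ℝ} (ha : 0 ≤ a) (hb : 0 ≤ b) (hs : 0 < a + b) :
    wallF q c a b = (a + b) ^ q * wallF q c (a / (a + b)) (1 - a / (a + b)) := by
  have hu0 : 0 ≤ a / (a + b) := div_nonneg ha hs.le
  have hu1 : 0 ≤ 1 - a / (a + b) := by
    rw [sub_nonneg, div_le_one hs]; linarith
  have ea : (a + b) * (a / (a + b)) = a := by field_simp
  have eb : (a + b) * (1 - a / (a + b)) = b := by field_simp; ring
  rw [← wallF_smul q c hs.le hu0 hu1, ea, eb]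

/-- On the eigen-sector, `u = a/(a + b) ∈ [1/3, 2/3]`. -/
theorem sector_ratio_mem {a b : ℝ} (hb2 : b ≤ 2 * a) (ha2 : a ≤ 2 * b) (hs : 0 < a + b) :
    a / (a + b) ∈ Icc (1 / 3 : ℝ) (2 / 3) := by
  constructor
  · rw [le_div_iff₀ hs]; linarith
  · rw [div_le_iff₀ hs]; linarith

/-- **(N) on the segment gives `F ≥ 0` on the whole eigen-sector** (homogeneity). [ours] -/
theorem wallF_sector_nonneg {q c : ℝ} (hq : 1 ≤ q)
    (hN : ∀ ⦃u : ℝ⦄, 1 / 3 ≤ u → u ≤ 2 / 3 → 0 ≤ wallF q c u (1 - u))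
    {a b : ℝ} (ha : 0 ≤ a) (hb : 0 ≤ b) (hb2 : b ≤ 2 * a) (ha2 : a ≤ 2 * b) :
    0 ≤ wallF q c a b := by
  rcases (add_nonneg ha hb).eq_or_lt with hs | hs
  · have h0 : a = 0 ∧ b = 0 := ⟨by linarith, by linarith⟩
    rw [h0.1, h0.2, wallF_zero (by linarith) c]
  · obtain ⟨hu1, hu2⟩ := sector_ratio_mem hb2 ha2 hs
    rw [wallF_eq_homog q c ha hb hs]
    exact mul_nonneg (rpow_nonneg hs.le q) (hN hu1 hu2)

/-- `F_{q,c} ≤ (a + b)^q` on the quadrant (`c ≥ 0`, `q ≥ 1`; Mathlib `add_rpow_le_rpow_add`). -/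
theorem wallF_le {q c : ℝ} (hq : 1 ≤ q) (hc : 0 ≤ c) {a b : ℝ} (ha : 0 ≤ a) (hb : 0 ≤ b) :
    wallF q c a b ≤ (a + b) ^ q := by
  unfold wallF
  have h1 := add_rpow_le_rpow_add ha hb hq
  have h2 : 0 ≤ c * (2 * (a ^ 2 - a * b + b ^ 2)) ^ (q / 2) :=
    mul_nonneg hc (rpow_nonneg (two_mul_quad_nonneg a b) _)
  linarith

/-! ## 2. The gauge `G = F^{1/q}` on the eigen-sector -/

/-- **The wall gauge** `G_{q,c}(a, b) = F_{q,c}(a, b)^{1/q}`. [ours] -/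
def wallG (q c a b : ℝ) : ℝ := wallF q c a b ^ q⁻¹

/-- `ψ_{q,c}(u) = G_{q,c}(u, 1 − u) = F_{q,c}(u, 1 − u)^{1/q}` — the one-variable profile whose
convexity on `[1/3, 2/3]` is hypothesis (C). [ours] -/
def wallPsi (q c u : ℝ) : ℝ := wallG q c u (1 - u)

/-- `G_{q,c}(a, b) ≥ 0` where `F_{q,c}(a, b) ≥ 0`. [bookkeeping] -/
theorem wallG_nonneg {q c a b : ℝ} (hF : 0 ≤ wallF q c a b) : 0 ≤ wallG q c a b := rpow_nonneg hF _

/-- `G_{q,c}(0, 0) = 0` for `q ≠ 0`. [bookkeeping] -/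
theorem wallG_zero {q : ℝ} (hq : q ≠ 0) (c : ℝ) : wallG q c 0 0 = 0 := by
  rw [wallG, wallF_zero hq, zero_rpow (inv_ne_zero hq)]

/-- `G` is positively `1`-homogeneous (where `F ≥ 0`). -/
theorem wallG_smul {q c : ℝ} (hq : q ≠ 0) {t a b : ℝ} (ht : 0 ≤ t) (ha : 0 ≤ a) (hb : 0 ≤ b)
    (hF : 0 ≤ wallF q c a b) : wallG q c (t * a) (t * b) = t * wallG q c a b := by
  rw [wallG, wallG, wallF_smul q c ht ha hb, mul_rpow (rpow_nonneg ht q) hF, rpow_rpow_inv ht hq]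

/-- `G^q = F` (where `F ≥ 0`). -/
theorem wallG_rpow {q c a b : ℝ} (hq : q ≠ 0) (hF : 0 ≤ wallF q c a b) :
    wallG q c a b ^ q = wallF q c a b := by
  rw [wallG, rpow_inv_rpow hF hq]

/-- `G ≤ a + b` on the quadrant where `F ≥ 0`. -/
theorem wallG_le {q c : ℝ} (hq : 1 ≤ q) (hc : 0 ≤ c) {a b : ℝ} (ha : 0 ≤ a) (hb : 0 ≤ b)
    (hF : 0 ≤ wallF q c a b) : wallG q c a b ≤ a + b := by
  have hq0 : q ≠ 0 := by linarith
  have h := rpow_le_rpow hF (wallF_le hq hc ha hb) (inv_nonneg.2 (by linarith : (0 : ℝ) ≤ q))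
  rwa [rpow_rpow_inv (add_nonneg ha hb) hq0] at h

/-- On the eigen-sector, `G(a, b) = (a + b)·ψ(a/(a + b))` with `a/(a + b) ∈ [1/3, 2/3]`. [ours] -/
theorem wallG_eq_psi {q c : ℝ} (hq : 1 ≤ q)
    (hN : ∀ ⦃u : ℝ⦄, 1 / 3 ≤ u → u ≤ 2 / 3 → 0 ≤ wallF q c u (1 - u))
    {a b : ℝ} (hb2 : b ≤ 2 * a) (ha2 : a ≤ 2 * b) (hs : 0 < a + b) :
    wallG q c a b = (a + b) * wallPsi q c (a / (a + b)) ∧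
      a / (a + b) ∈ Icc (1 / 3 : ℝ) (2 / 3) := by
  have hu := sector_ratio_mem hb2 ha2 hs
  refine ⟨?_, hu⟩
  have ea : a = (a + b) * (a / (a + b)) := by field_simp
  have eb : b = (a + b) * (1 - a / (a + b)) := by field_simp; ring
  rw [wallPsi, ← wallG_smul (by linarith) hs.le (by linarith [hu.1]) (by linarith [hu.2])
    (hN hu.1 hu.2), ← ea, ← eb]

/-- **(C) + homogeneity: `G` is subadditive on the eigen-sector.** [ours] -/
theorem wallG_add_le {q c : ℝ} (hq : 1 ≤ q)
    (hN : ∀ ⦃u : ℝ⦄, 1 / 3 ≤ u → u ≤ 2 / 3 → 0 ≤ wallF q c u (1 - u))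
    (hC : ConvexOn ℝ (Icc (1 / 3 : ℝ) (2 / 3)) (wallPsi q c))
    {a b a' b' : ℝ} (ha : 0 ≤ a) (hb : 0 ≤ b) (hb2 : b ≤ 2 * a) (ha2 : a ≤ 2 * b)
    (ha' : 0 ≤ a') (hb' : 0 ≤ b') (hb2' : b' ≤ 2 * a') (ha2' : a' ≤ 2 * b') :
    wallG q c (a + a') (b + b') ≤ wallG q c a b + wallG q c a' b' := by
  have hq0 : q ≠ 0 := by linarith
  rcases (add_nonneg ha hb).eq_or_lt with hs | hs
  · have h0 : a = 0 ∧ b = 0 := ⟨by linarith, by linarith⟩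
    rw [h0.1, h0.2, zero_add, zero_add, wallG_zero hq0, zero_add]
  rcases (add_nonneg ha' hb').eq_or_lt with hs' | hs'
  · have h0 : a' = 0 ∧ b' = 0 := ⟨by linarith, by linarith⟩
    rw [h0.1, h0.2, add_zero, add_zero, wallG_zero hq0, add_zero]
  have hT : 0 < a + a' + (b + b') := by linarith
  obtain ⟨e1, hu⟩ := wallG_eq_psi hq hN hb2 ha2 hs
  obtain ⟨e2, hv⟩ := wallG_eq_psi hq hN hb2' ha2' hs'
  obtain ⟨e3, -⟩ := wallG_eq_psi hq hN (b := b + b') (by linarith) (by linarith) hT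
  have hw : (a + a') / (a + a' + (b + b')) =
      (a + b) / (a + a' + (b + b')) * (a / (a + b)) +
        (a' + b') / (a + a' + (b + b')) * (a' / (a' + b')) := by
    field_simp
  have hconv := hC.2 hu hv (div_nonneg hs.le hT.le) (div_nonneg hs'.le hT.le)
    (by field_simp; ring)
  simp only [smul_eq_mul] at hconv
  rw [← hw] at hconv
  rw [e1, e2, e3]
  calc (a + a' + (b + b')) * wallPsi q c ((a + a') / (a + a' + (b + b')))
      ≤ (a + a' + (b + b')) * ((a + b) / (a + a' + (b + b')) * wallPsi q c (a / (a + b)) +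
          (a' + b') / (a + a' + (b + b')) * wallPsi q c (a' / (a' + b'))) :=
        mul_le_mul_of_nonneg_left hconv hT.le
    _ = (a + b) * wallPsi q c (a / (a + b)) + (a' + b') * wallPsi q c (a' / (a' + b')) := by
        field_simp

/-- **(M) + (N): `G` is non-decreasing on the eigen-sector.** [ours] -/
theorem wallG_mono {q c : ℝ} (hq : 1 ≤ q)
    (hN : ∀ ⦃u : ℝ⦄, 1 / 3 ≤ u → u ≤ 2 / 3 → 0 ≤ wallF q c u (1 - u))
    (hM : ∀ ⦃a b a' b' : ℝ⦄, 0 ≤ a → 0 ≤ b → b ≤ 2 * a → a ≤ 2 * b → b' ≤ 2 * a' → a' ≤ 2 * b' →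
      a ≤ a' → b ≤ b' → wallF q c a b ≤ wallF q c a' b')
    {a b a' b' : ℝ} (ha : 0 ≤ a) (hb : 0 ≤ b) (hb2 : b ≤ 2 * a) (ha2 : a ≤ 2 * b)
    (hb2' : b' ≤ 2 * a') (ha2' : a' ≤ 2 * b') (haa' : a ≤ a') (hbb' : b ≤ b') :
    wallG q c a b ≤ wallG q c a' b' :=
  rpow_le_rpow (wallF_sector_nonneg hq hN ha hb hb2 ha2) (hM ha hb hb2 ha2 hb2' ha2' haa' hbb')
    (inv_nonneg.2 (by linarith))

/-! ## 3. The wall gauge on tensors: `h(A) = G(λ(πA), λ(−πA))/2` -/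

/-- **The wall gauge** `h_{q,c}(A) = F_{q,c}(λ(πA), λ(−πA))^{1/q}/2`, `π` = trace-free symmetric
part. [ours] -/
def wallGauge (q c : ℝ) (A : Tens3) : ℝ := wallG q c (lam (tfProj A)) (lam (-tfProj A)) / 2

section criterion

variable {q c : ℝ} (hq : 1 ≤ q) (hc : 0 ≤ c)
  (hN : ∀ ⦃u : ℝ⦄, 1 / 3 ≤ u → u ≤ 2 / 3 → 0 ≤ wallF q c u (1 - u))
  (hM : ∀ ⦃a b a' b' : ℝ⦄, 0 ≤ a → 0 ≤ b → b ≤ 2 * a → a ≤ 2 * b → b' ≤ 2 * a' → a' ≤ 2 * b' →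
    a ≤ a' → b ≤ b' → wallF q c a b ≤ wallF q c a' b')
  (hC : ConvexOn ℝ (Icc (1 / 3 : ℝ) (2 / 3)) (wallPsi q c))

include hq hN in
/-- `F ≥ 0` at the eigen-pair of `πA`. -/
theorem wallF_lam_tfProj_nonneg (A : Tens3) :
    0 ≤ wallF q c (lam (tfProj A)) (lam (-tfProj A)) :=
  have hP := isSymTF_tfProj A
  wallF_sector_nonneg hq hN hP.lam_nonneg hP.lam_neg_nonneg hP.lam_sector.1 hP.lam_sector.2

include hq hN in
/-- The wall gauge is non-negative (under hypothesis (N)). [bookkeeping] -/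
theorem wallGauge_nonneg (A : Tens3) : 0 ≤ wallGauge q c A :=
  div_nonneg (wallG_nonneg (wallF_lam_tfProj_nonneg hq hN A)) two_pos.le

include hq hN hM hC in
/-- Subadditivity of the wall gauge ((M) + (C) + `λ` subadditive). [ours] -/
theorem wallGauge_add_le (A B : Tens3) :
    wallGauge q c (A + B) ≤ wallGauge q c A + wallGauge q c B := by
  have hA := isSymTF_tfProj A
  have hB := isSymTF_tfProj B
  have hAB := isSymTF_tfProj (A + B)
  have ha : lam (tfProj (A + B)) ≤ lam (tfProj A) + lam (tfProj B) := by
    rw [tfProj_add]; exact lam_add_le _ _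
  have hb : lam (-tfProj (A + B)) ≤ lam (-tfProj A) + lam (-tfProj B) := by
    rw [tfProj_add, neg_add]; exact lam_add_le _ _
  have h1 := wallG_mono hq hN hM hAB.lam_nonneg hAB.lam_neg_nonneg hAB.lam_sector.1 hAB.lam_sector.2
    (by linarith [hA.lam_sector.1, hB.lam_sector.1]) (by linarith [hA.lam_sector.2, hB.lam_sector.2])
    ha hb
  have h2 := wallG_add_le hq hN hC hA.lam_nonneg hA.lam_neg_nonneg hA.lam_sector.1 hA.lam_sector.2
    hB.lam_nonneg hB.lam_neg_nonneg hB.lam_sector.1 hB.lam_sector.2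
  unfold wallGauge
  linarith

include hq hN in
/-- Positive homogeneity of the wall gauge. [ours] -/
theorem wallGauge_smul {t : ℝ} (ht : 0 ≤ t) (A : Tens3) :
    wallGauge q c (t • A) = t * wallGauge q c A := by
  have hA := isSymTF_tfProj A
  unfold wallGauge
  rw [tfProj_smul, ← smul_neg, lam_smul ht, lam_smul ht,
    wallG_smul (by linarith) ht hA.lam_nonneg hA.lam_neg_nonneg (wallF_lam_tfProj_nonneg hq hN A)]
  ring

include hq hN hM hC in
/-- **The wall gauge is convex.** [ours] -/
theorem convexOn_wallGauge : ConvexOn ℝ univ (wallGauge q c) := by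
  refine ⟨convex_univ, fun A _ B _ a b ha hb _ => ?_⟩
  calc wallGauge q c (a • A + b • B) ≤ wallGauge q c (a • A) + wallGauge q c (b • B) :=
        wallGauge_add_le hq hN hM hC _ _
    _ = a • wallGauge q c A + b • wallGauge q c B := by
        rw [wallGauge_smul hq hN ha, wallGauge_smul hq hN hb]; rfl

include hq hc hN in
/-- `h(A) ≤ ‖A‖`. [ours] -/
theorem wallGauge_le_norm (A : Tens3) : wallGauge q c A ≤ ‖A‖ := by
  have hA := isSymTF_tfProj A
  have h1 := wallG_le hq hc hA.lam_nonneg hA.lam_neg_nonneg (wallF_lam_tfProj_nonneg hq hN A)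
  have h2 : lam (tfProj A) ≤ ‖tfProj A‖ := lam_le_norm _
  have h3 : lam (-tfProj A) ≤ ‖tfProj A‖ := (lam_le_norm _).trans (norm_neg _).le
  have h4 := norm_tfProj_le A
  unfold wallGauge
  linarith

include hq hc hN hM hC in
/-- **The wall gauge is `1`-Lipschitz.** [ours] -/
theorem lipschitzWith_wallGauge : LipschitzWith 1 (wallGauge q c) :=
  LipschitzWith.of_le_add fun A B => by
    have h1 := wallGauge_add_le hq hN hM hC B (A - B)
    rw [add_sub_cancel] at h1
    have h2 := wallGauge_le_norm hq hc hN (A - B)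
    rw [dist_eq_norm]; linarith

/-- `‖A‖^q = (2(λ(A)² − λ(A)λ(−A) + λ(−A)²))^{q/2}` on symmetric trace-free tensors. -/
theorem IsSymTF.norm_rpow_eq_lam {A : Tens3} (hA : IsSymTF A) (q : ℝ) :
    ‖A‖ ^ q = (2 * (lam A ^ 2 - lam A * lam (-A) + lam (-A) ^ 2)) ^ (q / 2) := by
  rw [← hA.norm_sq_eq_lam, sq_rpow_half (q := q) (norm_nonneg A)]

include hq hN in
/-- **The wall splitting identity** on symmetric trace-free tensors:
`λ(A)^q + λ(−A)^q = 2^q·h(A)^q + c‖A‖^q` (needs only (N)). [ours] -/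
theorem wall_splitting_identity {A : Tens3} (hA : IsSymTF A) :
    lam A ^ q + lam (-A) ^ q = 2 ^ q * wallGauge q c A ^ q + c * ‖A‖ ^ q := by
  have hq0 : q ≠ 0 := by linarith
  have hF : 0 ≤ wallF q c (lam A) (lam (-A)) := by
    have h := wallF_lam_tfProj_nonneg hq hN A
    rwa [tfProj_of_isSymTF hA] at h
  have h2q : (0 : ℝ) < 2 ^ q := rpow_pos_of_pos two_pos q
  have e : (2 : ℝ) ^ q * wallGauge q c A ^ q = wallF q c (lam A) (lam (-A)) := by
    unfold wallGauge
    rw [tfProj_of_isSymTF hA, div_rpow (wallG_nonneg hF) two_pos.le, wallG_rpow hq0 hF,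
      mul_div_cancel₀ _ h2q.ne']
  rw [e, hA.norm_rpow_eq_lam q]
  unfold wallF
  ring

include hq hc hN hM hC in
/-- **K18 — the wall criterion**: (N) ∧ (M) ∧ (C) ⟹ `TopBotEigSplitting q c`, witness `M = 2^q`,
`h = wallGauge q c`. [ours] -/
theorem topBotEigSplitting_of_wall : TopBotEigSplitting q c :=
  ⟨2 ^ q, rpow_nonneg two_pos.le q, wallGauge q c, convexOn_wallGauge hq hN hM hC,
    lipschitzWith_wallGauge hq hc hN hM hC,
    fun A hs ht => ⟨wallGauge_nonneg hq hN A, wall_splitting_identity hq hN ⟨hs, ht⟩⟩⟩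

end criterion

/-! ## 4. Consistency check: the criterion re-derives K17 at `q = 4`, `c = 2/9` -/

/-- At `q = 4`, `c = 2/9` the wall defect is K17's `quartF` (everywhere). -/
theorem wallF_four : wallF 4 (2 / 9) = quartF := by
  funext a b
  have h1 : (2 * (a ^ 2 - a * b + b ^ 2)) ^ ((4 : ℝ) / 2) = (2 * (a ^ 2 - a * b + b ^ 2)) ^ 2 := by
    norm_num
  unfold wallF quartF
  rw [h1, rpow_ofNat, rpow_ofNat]
  ring

/-- At `q = 4`, `c = 2/9` the profile `ψ` is K17's `segPsi`. -/
theorem wallPsi_four : wallPsi 4 (2 / 9) = segPsi := by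
  funext u
  simp only [wallPsi, wallG, wallF_four, segPsi, segN]

/- **K17 re-derived from the criterion** (a kernel-checked `example`, v2; the statement is K17's
`topBotEigSplitting_four_sharp` by name): (N), (M), (C) at `q = 4`, `c = 2/9` are K17's
`quartF_nonneg`, `quartF_mono`, `convexOn_segPsi`. -/
example : TopBotEigSplitting 4 (2 / 9) := by
  refine topBotEigSplitting_of_wall (by norm_num) (by norm_num) ?_ ?_ ?_
  · intro u hu1 hu2
    rw [wallF_four]; exact quartF_nonneg (by linarith) (by linarith)
  · intro a b a' b' ha hb _ _ _ _ haa' hbb'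
    rw [wallF_four]; exact quartF_mono ha hb haa' hbb'
  · rw [wallPsi_four]; exact convexOn_segPsi

/-! ## 5. Sanity values -/

/-- `F_{q,c}` at the prolate axis `(a, b) = (2, 1)` (`u = 2/3`): `2^q + 1 − c·6^{q/2}`; at the planar
point `(1, 1)`: `2 − c·2^{q/2}`. -/
example (q c : ℝ) : wallF q c 2 1 = 2 ^ q + 1 - c * 6 ^ (q / 2) ∧
    wallF q c 1 1 = 2 - c * 2 ^ (q / 2) := by
  refine ⟨?_, ?_⟩ <;> norm_num [wallF]

end TopEig

end Summit.NavierStokesRegularity.FunctionalMining
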